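import Literature.NumberTheory.Automorphic.UnitaryGroupAutomorphicRep
import Mathlib.Analysis.Matrix.PosDef
import Mathlib.NumberTheory.NumberField.CMField
import HarnessLib

/-!
# `U(J)(E ⊗ ℝ)` for a general hermitian matrix `J`, and its compactness for totally definite `J`
(Platonov–Rapinchuk, *Algebraic Groups and Number Theory* (1994), §2.3, §3.2;
Borel–Jacquet, *Automorphic forms and automorphic representations*, PSPM 33.1 (1979), §4.1;
Knapp, *Lie Groups Beyond an Introduction* (2002), I.§1, I.§17)

Topic `NumberTheory/Automorphic`; namespace `Literature.NumberTheory.Automorphic` (sub-namespace `UnitaryGroup`).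
Definitions and proved theorems only: **no named facts, no `sorry`**.

**Setting** — that of `UnitaryGroupAutomorphicRep`: `E/F` number fields, `c : E ≃ₐ[F] E`, `N : ℕ`, and a
GENERAL matrix `J ∈ M_N(E)` (the tree's `UnitaryGroup.archGroup` treats the *standard* integer involutions
`S : StdForm N` only, because only for those is `U(J₀)(E ⊗ ℝ)` a `RealMatrixGroup` in the given coordinates;
the definite hermitian forms of the theta correspondence — `diag(α₁, …, α_N)` with `αᵢ ∈ F` totally positive — are
not of that shape).

* `UnitaryGroup.archFormOf E N J = J ⊗ 1 ∈ M_N(E ⊗ ℝ)` (`J.map (mixedEmbedding E)`);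
* **`UnitaryGroup.arch F E c N J ≤ GL_N(E ⊗ ℝ)`** — `U(J)(E ⊗_ℚ ℝ) = {g | ((c ⊗ 1) g)ᵀ (J ⊗ 1) g = J ⊗ 1}`
  (`unitaryGroupOfForm (conjMixed F E c) (J ⊗ 1)`); closed; `arch … (S.over E) = (archGroup … S).carrier` for standard
  forms (`arch_over`);
* `UnitaryGroup.ofInfinite_mem_adelic_iff : (g, 1) ∈ U(J)(𝔸_F) ↔ g ∈ U(J)(E ⊗ ℝ)` and
  `archToAdelic : arch →* (adelicGroupData F E c N J).Adelic` (continuous, injective) — the archimedean component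
  of the tree's adelic group datum for a general `J`;
* **`Matrix.exists_norm_entry_le_of_posDef`** — for a positive definite hermitian `H ∈ M_n(𝕜)` (`𝕜 = ℝ, ℂ`) the
  solutions of `Mᴴ H M = H` have uniformly bounded entries (the unitary group of a definite form is bounded; proof by
  the minimum of the hermitian form on the unit sphere — no diagonalisation);
* `UnitaryGroup.isComplex_of_smul_eq` — if `c ≠ 1` fixes an infinite place `w` of `E` then `w` is complex (a real
  place fixed by `c` forces `c = 1`); so under "`c` fixes every infinite place" `E` is totally complex and `c ⊗ 1`
  is coordinatewise complex conjugation (`conjCoord_eq_conj`, tree);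
* the MAIN THEOREM **`UnitaryGroup.isCompact_arch`**: if `c ≠ 1` fixes every infinite place of `E` and `J` is
  **totally definite** (`σ_w(J)` or `-σ_w(J)` is a positive definite hermitian matrix for every complex place `w`;
  e.g. every non-degenerate hermitian LINE `J = (α)`, `α ∈ F^×`, in the CM case), then
  `U(J)(E ⊗ ℝ)` is COMPACT — "anisotropic at infinity ⇒ compact at infinity" for unitary groups
  (Platonov–Rapinchuk 1994, §3.2, Thm 3.1 (archimedean case: `G_{F_v}` compact iff `G` is `F_v`-anisotropic) together
  with §2.3 (a hermitian form over `ℂ/ℝ` is anisotropic iff definite));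
* the CM case **`UnitaryGroup.isCompact_arch_cm`** (`F = L⁺ = maximalRealSubfield L`, `E = L` a CM field,
  `c = IsCMField.complexConj L`, which is `≠ 1` and fixes every infinite place — `complexConj_smul_infinitePlace`)
  and the non-degeneracy witness `isCompact_arch_cm_one` (`H = 1`: `∏_{v∣∞} U(N)` is compact).

## Mathlib / tree

Mathlib: `Matrix.PosDef` (+ `Matrix.PosDef.re_dotProduct_pos`), `NumberField.mixedEmbedding`, `IsCMField.complexConj`
(+ `complexConj_ne_one`, `infinitePlace_complexConj`),
`InfinitePlace` with its `Gal`-action (`smul_mk`, `mk_eq_iff`), `Units.isEmbedding_embedProduct`,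
`isCompact_univ_pi`, `IsCompact.exists_isMinOn`. Tree: `UnitaryGroupAutomorphicRep` (`unitaryGroupOfForm`,
`conjMixed`, `conjMixed_snd_self`, `conjCoord_eq_conj`, `adelic`, `GLn.ofInfinite`, `matrix_adele_ext`).
Nothing is restated.

## Provenance

Written under the LEAN-IN-TREE rule (2026-08-18) for the pub-hodgecm formalisation cell (model-construction
sub-cell, seat mc-unitary-2, MODEL-DAG node U2: "compactness at `∞` for definite `H`"). In the CM case
(`F = L⁺` totally real, `E = L`, `c` = complex conjugation, which fixes every infinite place of `L`) and `H` a
totally definite hermitian matrix, `isCompact_arch` is the compactness of `U(H)(L ⊗ ℝ) = ∏_{v∣∞} U(N)`.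
Nothing in this file is a claim of the manuscripts adjudicated by that cell.

## References

* V. Platonov, A. Rapinchuk, *Algebraic Groups and Number Theory*, Academic Press (1994), §2.3 and §3.2
  Thm 3.1 [PlatonovRapinchuk1994].
* A. Borel, H. Jacquet, *Automorphic forms and automorphic representations*, PSPM 33.1 (1979), §4.1
  [BorelJacquet1979].
* A. W. Knapp, *Lie Groups Beyond an Introduction*, 2nd ed. (2002), I.§1, I.§17 (compact classical groups
  `U(n)`, `O(n)` defined by definite forms) [Knapp2002].
-/

set_option autoImplicit false

noncomputable section

open NumberField IsDedekindDomain Topology Filter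
open scoped Matrix MatrixGroups ComplexOrder

namespace Literature.NumberTheory.Automorphic

/-! ## 1. Definite forms have bounded unitary groups -/

section EntryBound

variable {𝕜 : Type*} [RCLike 𝕜] {n : Type*} [Fintype n] [DecidableEq n]

omit [DecidableEq n] in
/-- The real part of the hermitian form `x ↦ xᴴ H x` is invariant under `M` with `Mᴴ H M = H`. [folklore] -/
theorem Matrix.re_star_dotProduct_mulVec_mulVec {H M : Matrix n n 𝕜} (hM : Mᴴ * H * M = H) (x : n → 𝕜) :
    RCLike.re (star (M *ᵥ x) ⬝ᵥ (H *ᵥ (M *ᵥ x))) = RCLike.re (star x ⬝ᵥ (H *ᵥ x)) := by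
  rw [Matrix.star_mulVec, Matrix.mulVec_mulVec, Matrix.dotProduct_mulVec, Matrix.vecMul_vecMul,
    ← Matrix.mul_assoc, hM, ← Matrix.dotProduct_mulVec]

omit [DecidableEq n] in
/-- Homogeneity of the hermitian form under real scalars: `q (t • x) = t² · q x`. [folklore] -/
theorem Matrix.re_star_dotProduct_mulVec_real_smul (H : Matrix n n 𝕜) (t : ℝ) (x : n → 𝕜) :
    RCLike.re (star ((t : 𝕜) • x) ⬝ᵥ (H *ᵥ ((t : 𝕜) • x))) = t ^ 2 * RCLike.re (star x ⬝ᵥ (H *ᵥ x)) := by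
  rw [star_smul, Matrix.mulVec_smul, smul_dotProduct, dotProduct_smul, smul_smul, smul_eq_mul,
    RCLike.star_def, RCLike.conj_ofReal, ← RCLike.ofReal_mul, RCLike.re_ofReal_mul, sq]

/-- **Definite forms have bounded unitary groups.** For a positive definite hermitian `H ∈ M_n(𝕜)` there is a
constant `C` with `‖M i j‖ ≤ C` for every solution of `Mᴴ · H · M = H` (proof: the continuous function
`x ↦ Re(xᴴ H x)` has a positive minimum `m` on the unit sphere, so `m ‖x‖² ≤ Re(xᴴ H x)`; apply to the
columns `x = M e_j`, for which `Re(xᴴ H x) = Re(e_jᴴ H e_j)`). [cite: Knapp2002, I.§1] -/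
theorem Matrix.exists_norm_entry_le_of_posDef {H : Matrix n n 𝕜} (hH : H.PosDef) :
    ∃ C : ℝ, ∀ M : Matrix n n 𝕜, Mᴴ * H * M = H → ∀ i j, ‖M i j‖ ≤ C := by
  rcases isEmpty_or_nonempty n with hn | ⟨⟨i₀⟩⟩
  · exact ⟨0, fun M _ i => isEmptyElim i⟩
  -- the hermitian form and its basic properties
  set q : (n → 𝕜) → ℝ := fun x => RCLike.re (star x ⬝ᵥ (H *ᵥ x)) with hq
  have hq_cont : Continuous q :=
    RCLike.continuous_re.comp ((continuous_star).dotProduct (continuous_const.matrix_mulVec continuous_id))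
  -- minimum on the unit sphere
  set S : Set (n → 𝕜) := Metric.sphere 0 1 with hS
  have hScpt : IsCompact S := isCompact_sphere 0 1
  have hSne : S.Nonempty := ⟨Pi.single i₀ 1, by simp [hS, Pi.norm_single]⟩
  obtain ⟨x₀, hx₀S, hmin⟩ := hScpt.exists_isMinOn hSne hq_cont.continuousOn
  have hx₀ : x₀ ≠ 0 := by
    intro h
    rw [h, hS, Metric.mem_sphere, dist_zero_right, norm_zero] at hx₀S
    exact zero_ne_one hx₀S
  set m : ℝ := q x₀ with hm
  have hm_pos : 0 < m := hH.re_dotProduct_pos hx₀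
  -- `m ‖x‖² ≤ q x` for every `x`
  have hbound : ∀ x : n → 𝕜, m * ‖x‖ ^ 2 ≤ q x := by
    intro x
    by_cases hx : x = 0
    · subst hx
      simp [hq]
    have hxn : 0 < ‖x‖ := norm_pos_iff.mpr hx
    set u : n → 𝕜 := ((‖x‖⁻¹ : ℝ) : 𝕜) • x with hu
    have huS : u ∈ S := by
      rw [hS, Metric.mem_sphere, dist_zero_right, hu, norm_smul, RCLike.norm_ofReal, abs_inv, abs_norm,
        inv_mul_cancel₀ hxn.ne']
    have h1 : m ≤ q u := hmin huS
    have h2 : q u = ‖x‖⁻¹ ^ 2 * q x := Matrix.re_star_dotProduct_mulVec_real_smul H _ x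
    rw [h2] at h1
    have h3 : m * ‖x‖ ^ 2 ≤ ‖x‖⁻¹ ^ 2 * q x * ‖x‖ ^ 2 :=
      mul_le_mul_of_nonneg_right h1 (sq_nonneg _)
    calc m * ‖x‖ ^ 2 ≤ ‖x‖⁻¹ ^ 2 * q x * ‖x‖ ^ 2 := h3
      _ = q x := by field_simp
  -- the constant
  set D : ℝ := ∑ j, q (Pi.single j 1) with hD
  have hDj : ∀ j, q (Pi.single j 1) ≤ D := fun j =>
    Finset.single_le_sum (f := fun j => q (Pi.single j 1)) (fun j _ => hH.posSemidef.re_dotProduct_nonneg _)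
      (Finset.mem_univ j)
  refine ⟨Real.sqrt (D / m), fun M hM i j => ?_⟩
  -- the `j`-th column of `M`
  have hcol : M *ᵥ Pi.single j 1 = fun i => M i j := by
    ext i
    simp [Matrix.mulVec, dotProduct_single]
  have hqcol : q (fun i => M i j) = q (Pi.single j 1) := by
    rw [← hcol]
    exact Matrix.re_star_dotProduct_mulVec_mulVec hM _
  have h1 : m * ‖(fun i => M i j)‖ ^ 2 ≤ D := (hbound _).trans (hqcol ▸ hDj j)
  have h2 : ‖(fun i => M i j)‖ ^ 2 ≤ D / m := by
    rw [le_div_iff₀ hm_pos, mul_comm]; exact h1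
  calc ‖M i j‖ ≤ ‖(fun i => M i j)‖ := norm_le_pi_norm (fun i => M i j) i
    _ = Real.sqrt (‖(fun i => M i j)‖ ^ 2) := (Real.sqrt_sq (norm_nonneg _)).symm
    _ ≤ Real.sqrt (D / m) := Real.sqrt_le_sqrt h2

end EntryBound

namespace UnitaryGroup

open NumberField.mixedEmbedding NumberField.InfinitePlace

variable (F E : Type) [Field F] [Field E] [NumberField E] [Algebra F E] (c : E ≃ₐ[F] E) (N : ℕ)
  (J : Matrix (Fin N) (Fin N) E)

/-! ## 2. `U(J)(E ⊗ ℝ)` for a general `J` -/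

/-- `J ⊗ 1 ∈ M_N(E ⊗_ℚ ℝ)` (entrywise `mixedEmbedding`). [folklore] -/
def archFormOf : Matrix (Fin N) (Fin N) (mixedSpace E) := J.map (mixedEmbedding E)

/-- **`U(J)(E ⊗_ℚ ℝ) = {g ∈ GL_N(E ⊗ ℝ) | ((c ⊗ 1) g)ᵀ · (J ⊗ 1) · g = J ⊗ 1}`**, the archimedean points of
the unitary group of a general `J` (the tree's `unitaryGroupOfForm` over `E ⊗ ℝ` with `c ⊗ 1 = conjMixed`).
[cite: BorelJacquet1979, §4.1] -/
def arch : Subgroup (GL (Fin N) (mixedSpace E)) :=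
  unitaryGroupOfForm (conjMixed F E c) (archFormOf E N J)

omit [NumberField E] in
/-- Membership in `U(J)(E ⊗ ℝ)` (definitional). [folklore] -/
theorem mem_arch_iff (g : GL (Fin N) (mixedSpace E)) :
    g ∈ arch F E c N J ↔
      ((g : Matrix (Fin N) (Fin N) (mixedSpace E)).map (conjMixed F E c))ᵀ * archFormOf E N J *
          (g : Matrix (Fin N) (Fin N) (mixedSpace E)) = archFormOf E N J :=
  Iff.rfl

omit [NumberField E] in
/-- `U(J)(E ⊗ ℝ)` is closed in `GL_N(E ⊗ ℝ)`. [folklore] -/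
theorem isClosed_arch : IsClosed (arch F E c N J : Set (GL (Fin N) (mixedSpace E))) := by
  have h1 : Continuous fun g : GL (Fin N) (mixedSpace E) => (g : Matrix (Fin N) (Fin N) (mixedSpace E)) :=
    Units.continuous_val
  have hc : Continuous fun g : GL (Fin N) (mixedSpace E) =>
      ((g : Matrix (Fin N) (Fin N) (mixedSpace E)).map (conjMixed F E c))ᵀ * archFormOf E N J *
        (g : Matrix (Fin N) (Fin N) (mixedSpace E)) :=
    ((h1.matrix_map (continuous_conjMixed F E c)).matrix_transpose.mul continuous_const).mul h1
  exact isClosed_eq hc continuous_const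

open scoped Classical in
/-- For a standard form, `U(J₀)(E ⊗ ℝ)` is the carrier of the tree's `archGroup` (H5 of that file: the
`RealMatrixGroup` structure needs the classical `Fintype` instances on the place subtypes). [folklore] -/
theorem arch_over (S : StdForm N) : arch F E c N (S.over E) = (archGroup F E c N S).carrier := by
  change unitaryGroupOfForm (conjMixed F E c) ((S.over E).map (mixedEmbedding E)) =
    unitaryGroupOfForm (conjMixed F E c) (archForm E N S)
  rw [S.over_map]

/-! ## 3. `(g, 1) ∈ U(J)(𝔸_F) ↔ g ∈ U(J)(E ⊗ ℝ)` and the archimedean component of the adelic datum -/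

section Adelic

variable [NumberField F]

omit [NumberField F] in
/-- The archimedean part of `J ⊗ 1 ∈ M_N(𝔸_E)` is `J ⊗ 1 ∈ M_N(E ⊗ ℝ)` transported to `E_∞`. [folklore] -/
theorem adelicForm_map_fst :
    (adelicForm E N J).map (adeleFst E) =
      (archFormOf E N J).map (InfiniteAdeleRing.ringEquiv_mixedSpace E).symm.toRingHom := by
  rw [adelicForm, archFormOf, Matrix.map_map, Matrix.map_map]
  congr 1
  funext x
  change (algebraMap E (AdeleRing (𝓞 E) E) x).1 = (InfiniteAdeleRing.ringEquiv_mixedSpace E).symm (mixedEmbedding E x)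
  rw [InfiniteAdeleRing.mixedEmbedding_eq_algebraMap_comp, RingEquiv.symm_apply_apply]
  rfl

omit [NumberField F] in
/-- The finite part of `J ⊗ 1 ∈ M_N(𝔸_E)`. [folklore] -/
theorem adelicForm_map_snd :
    (adelicForm E N J).map (adeleSnd E) = J.map (algebraMap E (FiniteAdeleRing (𝓞 E) E)) := by
  rw [adelicForm, Matrix.map_map]
  rfl

omit [NumberField F] in
/-- **`(g, 1) ∈ U(J)(𝔸_F) ↔ g ∈ U(J)(E ⊗ ℝ)`** (general `J`; the tree's `ofInfinite_mem_adelic` is the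
direction `←` for standard forms). [folklore] -/
theorem ofInfinite_mem_adelic_iff (g : GL (Fin N) (mixedSpace E)) :
    GLn.ofInfinite N E g ∈ adelic F E c N J ↔ g ∈ arch F E c N J := by
  rw [adelic, mem_unitaryGroupOfForm_iff, mem_arch_iff]
  set G : Matrix (Fin N) (Fin N) (AdeleRing (𝓞 E) E) := (GLn.ofInfinite N E g).val with hG
  set e' := (InfiniteAdeleRing.ringEquiv_mixedSpace E).symm.toRingHom with he'
  have hfst : G.map (adeleFst E) = g.val.map e' := map_fst_ofInfinite E N g
  have hsnd : G.map (adeleSnd E) = 1 := map_snd_ofInfinite E N g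
  have hσfst : (G.map (conjAdele F E c)).map (adeleFst E) = (g.val.map (conjMixed F E c)).map e' := by
    rw [Matrix.map_map, Matrix.map_map,
      show (adeleFst E ∘ conjAdele F E c : AdeleRing (𝓞 E) E → InfiniteAdeleRing E) =
        (MulSemiringAction.toRingHom (E ≃ₐ[F] E) (InfiniteAdeleRing E) c) ∘ adeleFst E from rfl,
      ← Matrix.map_map, hfst, Matrix.map_map]
    congr 1
    funext x
    exact (ringEquiv_symm_conjMixed F E c x).symm
  have hσsnd : (G.map (conjAdele F E c)).map (adeleSnd E) = 1 := by
    rw [Matrix.map_map,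
      show (adeleSnd E ∘ conjAdele F E c : AdeleRing (𝓞 E) E → FiniteAdeleRing (𝓞 E) E) =
        (MulSemiringAction.toRingHom (E ≃ₐ[F] E) (FiniteAdeleRing (𝓞 E) E) c) ∘ adeleSnd E from rfl,
      ← Matrix.map_map, hsnd, Matrix.map_one _ (map_zero _) (map_one _)]
  have hJfst := adelicForm_map_fst E N J
  have hJsnd := adelicForm_map_snd E N J
  have he'inj : Function.Injective (fun M : Matrix (Fin N) (Fin N) (mixedSpace E) => M.map e') :=
    fun A B h => (InfiniteAdeleRing.ringEquiv_mixedSpace E).symm.mapMatrix.injective h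
  constructor
  · intro h
    have key := congrArg (fun M : Matrix (Fin N) (Fin N) (AdeleRing (𝓞 E) E) => M.map (adeleFst E)) h
    simp only [Matrix.map_mul, Matrix.transpose_map] at key
    rw [hσfst, hfst, hJfst, ← Matrix.transpose_map] at key
    apply he'inj
    simp only [Matrix.map_mul, Matrix.transpose_map]
    rw [← Matrix.transpose_map]
    exact key
  · intro h
    refine matrix_adele_ext E N ?_ ?_
    · rw [Matrix.map_mul, Matrix.map_mul, Matrix.transpose_map, hσfst, hfst, hJfst]
      have key := congrArg (fun M : Matrix (Fin N) (Fin N) (mixedSpace E) => M.map e') h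
      simp only [Matrix.map_mul, Matrix.transpose_map] at key
      exact key
    · rw [Matrix.map_mul, Matrix.map_mul, Matrix.transpose_map, hσsnd, hsnd, hJsnd, Matrix.transpose_one,
        Matrix.one_mul, Matrix.mul_one]

/-- **`U(J)(E ⊗ ℝ) →* U(J)(𝔸_F)`, `g ↦ (g, 1)`** (restriction of the tree's `GLn.ofInfinite`), typed on the adelic
points of the datum `adelicGroupData F E c N J`: the archimedean component for a general `J`.
[cite: BorelJacquet1979, §4.1] -/
def archToAdelic : arch F E c N J →* (adelicGroupData F E c N J).Adelic :=
  ((GLn.ofInfinite N E).comp (arch F E c N J).subtype).codRestrict (adelic F E c N J)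
    fun g => (ofInfinite_mem_adelic_iff F E c N J g.1).2 g.2

/-- `archToAdelic g = (g, 1)` in `GL_N(𝔸_E)`. [folklore] -/
@[simp] theorem adelicVal_archToAdelic (g : arch F E c N J) :
    adelicVal F E c N J (archToAdelic F E c N J g) = GLn.ofInfinite N E g := rfl

/-- `archToAdelic` is continuous. [folklore] -/
theorem continuous_archToAdelic : Continuous (archToAdelic F E c N J) :=
  Continuous.subtype_mk ((GLn.continuous_ofInfinite N E).comp continuous_subtype_val) _

omit [NumberField F] in
/-- `GLn.ofInfinite` is injective (its archimedean part is a transport of the identity). [folklore] -/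
theorem ofInfinite_injective : Function.Injective (GLn.ofInfinite N E) := fun a b h => by
  have := congrArg (fun G : GL (Fin N) (AdeleRing (𝓞 E) E) => G.val.map (adeleFst E)) h
  simp only [map_fst_ofInfinite] at this
  exact Units.ext ((InfiniteAdeleRing.ringEquiv_mixedSpace E).symm.mapMatrix.injective this)

/-- `archToAdelic` is injective. [folklore] -/
theorem archToAdelic_injective : Function.Injective (archToAdelic F E c N J) := by
  intro a b h
  have h' := congrArg (adelicVal F E c N J) h
  simp only [adelicVal_archToAdelic] at h'
  exact Subtype.ext (ofInfinite_injective E N h')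

end Adelic

/-! ## 4. Places fixed by `c`; compactness of `U(J)(E ⊗ ℝ)` for totally definite `J` -/

omit [NumberField E] in
/-- **A real place fixed by `c ≠ 1` does not exist**: if `c • w = w` then `w` is complex (for a real place the
class of an embedding determines the embedding, so `σ_w ∘ c⁻¹ = σ_w` and `c = 1`). [folklore] -/
theorem isComplex_of_smul_eq (hc : c ≠ 1) {w : InfinitePlace E} (hw : c • w = w) : IsComplex w := by
  rw [← not_isReal_iff_isComplex]
  intro hreal
  apply hc
  set φ := w.embedding with hφdef
  have hφ : ComplexEmbedding.conjugate φ = φ :=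
    ComplexEmbedding.isReal_iff.mp (InfinitePlace.isReal_iff.mp hreal)
  rw [← mk_embedding w, smul_mk, mk_eq_iff] at hw
  have key : ∀ y : E, φ (c.symm y) = φ y := by
    intro y
    rcases hw with h | h
    · simpa using RingHom.congr_fun h y
    · have h' := RingHom.congr_fun h y
      have hz := RingHom.congr_fun hφ (c.symm y)
      rw [ComplexEmbedding.conjugate_coe_eq] at h' hz
      simp only [RingHom.coe_comp, RingHom.coe_coe, Function.comp_apply] at h'
      rw [hz] at h'
      exact h'
  ext x
  have h1 := key (c x)
  rw [AlgEquiv.symm_apply_apply] at h1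
  exact (φ.injective h1).symm

/-- The `w`-coordinate `E ⊗ ℝ →+* ℂ` at a complex place `w`. [folklore] -/
def evalC (w : {w : InfinitePlace E // IsComplex w}) : mixedSpace E →+* ℂ :=
  (Pi.evalRingHom _ w).comp (RingHom.snd _ _)

omit [NumberField E] in
/-- `evalC w x = x.2 w` (definitional). [folklore] -/
@[simp] theorem evalC_apply (w : {w : InfinitePlace E // IsComplex w}) (x : mixedSpace E) :
    evalC E w x = x.2 w := rfl

omit [NumberField E] in
/-- At a complex place fixed by `c ≠ 1`, `c ⊗ 1` is complex conjugation on the `w`-coordinate (tree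
`conjMixed_snd_self` + `conjCoord_eq_conj`). [folklore] -/
theorem evalC_conjMixed {w : {w : InfinitePlace E // IsComplex w}} (hw : c • w.1 = w.1) (hc : c ≠ 1)
    (x : mixedSpace E) : evalC E w (conjMixed F E c x) = starRingEnd ℂ (evalC E w x) := by
  rw [evalC_apply, conjMixed_snd_self hw, conjCoord_eq_conj F E c hw hc, evalC_apply]

omit [NumberField E] in
/-- The `w`-coordinate of `J ⊗ 1` is `σ_w(J)`. [folklore] -/
theorem archFormOf_map_evalC (w : {w : InfinitePlace E // IsComplex w}) :
    (archFormOf E N J).map (evalC E w) = J.map w.1.embedding := by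
  ext i j
  exact mixedEmbedding_apply_isComplex E (J i j) w

omit [NumberField E] in
/-- **Compactness at infinity for totally definite forms.** If `c ≠ 1` fixes every infinite place of `E` (so `E`
is totally complex and `c ⊗ 1` is coordinatewise complex conjugation — the CM situation) and `σ_w(J)` is a
DEFINITE hermitian matrix (positive or negative definite; the sign may depend on `w`) for every complex place `w`
of `E`, then `U(J)(E ⊗ ℝ)` is compact: its
matrix entries are bounded place by place (`Matrix.exists_norm_entry_le_of_posDef`), so it is a closed subset
of a compact box of `M_N(E ⊗ ℝ)`, and `GL_N ↪ M_N × M_Nᵐᵒᵖ` is an embedding under which it has closed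
bounded image. (Platonov–Rapinchuk 1994, §3.2 Thm 3.1 with §2.3: archimedean anisotropic ⇔ compact;
Knapp 2002, I.§1.) [cite: PlatonovRapinchuk1994, §3.2 Thm 3.1] -/
theorem isCompact_arch (hc : c ≠ 1) (hfix : ∀ w : InfinitePlace E, c • w = w)
    (hdef : ∀ w : {w : InfinitePlace E // IsComplex w},
      (J.map w.1.embedding).PosDef ∨ (-J.map w.1.embedding).PosDef) :
    IsCompact (arch F E c N J : Set (GL (Fin N) (mixedSpace E))) := by
  classical
  -- the matrix-level solution set
  set S : Set (Matrix (Fin N) (Fin N) (mixedSpace E)) :=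
    {M | (M.map (conjMixed F E c))ᵀ * archFormOf E N J * M = archFormOf E N J} with hSdef
  have hSclosed : IsClosed S :=
    isClosed_eq (((continuous_id.matrix_map (continuous_conjMixed F E c)).matrix_transpose.mul
      continuous_const).mul continuous_id) continuous_const
  -- entries are bounded at every complex place
  have hplace : ∀ w : {w : InfinitePlace E // IsComplex w}, ∃ C : ℝ, ∀ M ∈ S, ∀ i j, ‖(M i j).2 w‖ ≤ C := by
    intro w
    -- the `w`-coordinate of a solution solves `M_wᴴ σ_w(J) M_w = σ_w(J)`
    have hMw : ∀ M ∈ S,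
        (M.map (evalC E w))ᴴ * J.map w.1.embedding * M.map (evalC E w) = J.map w.1.embedding := by
      intro M hM
      have hconj : (M.map (⇑(evalC E w) ∘ ⇑(conjMixed F E c)))ᵀ = (M.map (evalC E w))ᴴ := by
        have hfun : (⇑(evalC E w) ∘ ⇑(conjMixed F E c)) = (star ∘ ⇑(evalC E w)) :=
          funext fun x => evalC_conjMixed F E c (hfix w.1) hc x
        rw [Matrix.conjTranspose, Matrix.transpose_map, Matrix.map_map, hfun]
      have key := congrArg (fun A : Matrix (Fin N) (Fin N) (mixedSpace E) => A.map (evalC E w)) hM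
      rw [← RingHom.mapMatrix_apply, map_mul, map_mul, RingHom.mapMatrix_apply, RingHom.mapMatrix_apply,
        RingHom.mapMatrix_apply, archFormOf_map_evalC, Matrix.transpose_map, Matrix.map_map, hconj] at key
      exact key
    rcases hdef w with hpos | hneg
    · obtain ⟨C, hC⟩ := Matrix.exists_norm_entry_le_of_posDef hpos
      exact ⟨C, fun M hM i j => hC _ (hMw M hM) i j⟩
    · obtain ⟨C, hC⟩ := Matrix.exists_norm_entry_le_of_posDef hneg
      refine ⟨C, fun M hM i j => hC (M.map (evalC E w)) ?_ i j⟩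
      rw [Matrix.mul_neg, Matrix.neg_mul, hMw M hM]
  choose C hC using hplace
  -- a compact box containing `S`
  set K : Set (mixedSpace E) :=
    (Set.univ.pi fun _ : {w : InfinitePlace E // IsReal w} => Metric.closedBall (0 : ℝ) 1) ×ˢ
      (Set.univ.pi fun w : {w : InfinitePlace E // IsComplex w} => Metric.closedBall (0 : ℂ) (C w)) with hKdef
  have hK : IsCompact K :=
    (isCompact_univ_pi fun _ => isCompact_closedBall _ _).prod
      (isCompact_univ_pi fun w => isCompact_closedBall _ _)
  set box : Set (Matrix (Fin N) (Fin N) (mixedSpace E)) := {M | ∀ i j, M i j ∈ K} with hboxdef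
  have hbox : IsCompact box := by
    have hb : box = Set.univ.pi fun _ : Fin N => Set.univ.pi fun _ : Fin N => K :=
      Set.ext fun M => ⟨fun h i _ j _ => h i j, fun h i j => h i (Set.mem_univ _) j (Set.mem_univ _)⟩
    rw [hb]
    exact isCompact_univ_pi fun _ => isCompact_univ_pi fun _ => hK
  have hSsub : S ⊆ box := by
    intro M hM i j
    refine Set.mk_mem_prod ?_ ?_
    · intro w' _
      exact absurd w'.2 (not_isReal_iff_isComplex.mpr (isComplex_of_smul_eq F E c hc (hfix w'.1)))
    · intro w _
      rw [Metric.mem_closedBall, dist_zero_right]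
      exact hC w M hM i j
  have hScpt : IsCompact S := hbox.of_isClosed_subset hSclosed hSsub
  -- transfer to `GL_N` along the embedding `Units.embedProduct`
  set T : Set (Matrix (Fin N) (Fin N) (mixedSpace E) × (Matrix (Fin N) (Fin N) (mixedSpace E))ᵐᵒᵖ) :=
    {p | p.1 ∈ S ∧ p.2.unop ∈ S ∧ p.1 * p.2.unop = 1 ∧ p.2.unop * p.1 = 1} with hTdef
  have h1 : Continuous fun p : Matrix (Fin N) (Fin N) (mixedSpace E) ×
      (Matrix (Fin N) (Fin N) (mixedSpace E))ᵐᵒᵖ => p.1 := continuous_fst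
  have h2 : Continuous fun p : Matrix (Fin N) (Fin N) (mixedSpace E) ×
      (Matrix (Fin N) (Fin N) (mixedSpace E))ᵐᵒᵖ => p.2.unop :=
    MulOpposite.continuous_unop.comp continuous_snd
  have hTclosed : IsClosed T :=
    (hSclosed.preimage h1).inter ((hSclosed.preimage h2).inter
      ((isClosed_eq (h1.mul h2) continuous_const).inter (isClosed_eq (h2.mul h1) continuous_const)))
  have hTsub : T ⊆ S ×ˢ (MulOpposite.op '' S) := by
    rintro ⟨a, b⟩ ⟨ha, hb, -, -⟩
    exact ⟨ha, b.unop, hb, rfl⟩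
  have hTcpt : IsCompact T :=
    (hScpt.prod (hScpt.image MulOpposite.continuous_op)).of_isClosed_subset hTclosed hTsub
  have himage : Units.embedProduct (Matrix (Fin N) (Fin N) (mixedSpace E)) ''
      (arch F E c N J : Set (GL (Fin N) (mixedSpace E))) = T := by
    ext p
    constructor
    · rintro ⟨g, hg, rfl⟩
      exact ⟨hg, (arch F E c N J).inv_mem hg, g.mul_inv, g.inv_mul⟩
    · rintro ⟨hp1, -, hp3, hp4⟩
      exact ⟨⟨p.1, p.2.unop, hp3, hp4⟩, hp1, Prod.ext rfl rfl⟩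
  rw [Units.isEmbedding_embedProduct.isCompact_iff, himage]
  exact hTcpt

/-! ## 5. The CM case: `U(H)(L ⊗ ℝ)` is compact for a totally definite hermitian `H` over a CM field -/

section CM

variable (L : Type) [Field L] [NumberField L] [IsCMField L] (H : Matrix (Fin N) (Fin N) L)

/-- Complex conjugation of a CM field fixes every infinite place (`|c x|_w = |x|_w`, Mathlib
`IsCMField.infinitePlace_complexConj`). [folklore] -/
theorem complexConj_smul_infinitePlace (w : InfinitePlace L) : IsCMField.complexConj L • w = w := by
  ext x
  rw [InfinitePlace.smul_apply, ← IsCMField.infinitePlace_complexConj L w ((IsCMField.complexConj L).symm x),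
    AlgEquiv.apply_symm_apply]

/-- **`U(H)(L ⊗_ℚ ℝ)` is compact** for a CM field `L` (over `F = L⁺`, `c` = complex conjugation) and a hermitian
`H ∈ M_N(L)` that is definite at every complex place (`isCompact_arch` with `IsCMField.complexConj_ne_one` and
`complexConj_smul_infinitePlace`). In particular `U(W)(L ⊗ ℝ) ≅ ∏_{v∣∞} U(1)` is compact for every
non-degenerate hermitian line `W`. (Platonov–Rapinchuk 1994, §3.2 Thm 3.1.) [cite: PlatonovRapinchuk1994, §3.2 Thm 3.1] -/
theorem isCompact_arch_cm
    (hdef : ∀ w : {w : InfinitePlace L // IsComplex w},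
      (H.map w.1.embedding).PosDef ∨ (-H.map w.1.embedding).PosDef) :
    IsCompact (arch (↥(maximalRealSubfield L)) L (IsCMField.complexConj L) N H :
      Set (GL (Fin N) (mixedSpace L))) :=
  isCompact_arch (↥(maximalRealSubfield L)) L (IsCMField.complexConj L) N H (IsCMField.complexConj_ne_one L)
    (complexConj_smul_infinitePlace L) hdef

/-- Non-degeneracy witness for the hypotheses: the STANDARD form `H = 1` is totally definite, so
`U_N(L ⊗ ℝ) = ∏_{v∣∞} U(N)` is compact (Knapp 2002, I.§17: `U(n)` is compact). [folklore] -/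
theorem isCompact_arch_cm_one :
    IsCompact (arch (↥(maximalRealSubfield L)) L (IsCMField.complexConj L) N (1 : Matrix (Fin N) (Fin N) L) :
      Set (GL (Fin N) (mixedSpace L))) :=
  isCompact_arch_cm (N := N) (L := L) (H := 1) fun w =>
    Or.inl (by rw [Matrix.map_one _ (map_zero _) (map_one _)]; exact Matrix.PosDef.one)

end CM

end UnitaryGroup

end Literature.NumberTheory.Automorphic

end
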